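import Summits.Ventures.YMGap.Thresholds.SharpImprovedThresholdFree
import Summits.Ventures.YMGap.Thresholds.SharpStrongCouplingOfUniqueness
import HarnessLib

/-!
# Venture YMGap — OBJECT U corollaries: the unique thermodynamic limit and the strong-coupling PHASE statement
# at the sharp window, HYPOTHESIS-FREE

HONEST FRAMING: venture file (cell `pub-ymgap`, track (a), OBJECT U follow-up to the capstone
`SharpImprovedThresholdFree`, seat p1; plumbing by p2's `SharpStrongCouplingOfUniqueness`). LATTICE strong-coupling
statements for `SU(N)` Wilson lattice Yang–Mills on `ℤ^d`; nothing about the continuum. Three-line compositions of the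
capstone's `sharpUniqueness_free` / the tree theorem `shenZhuZhu_massGap_transfer_holds` with p2's doors: for every
`N ≥ 2` and every tree coupling `|β| < N/(8d)` ('t Hooft `|β|/N < 1/(8d)`): the full sequence of periodic `SU(N)` Wilson
states converges to ONE translation-invariant infinite-volume state (`HasUniqueInfiniteVolumeLimit`), and the tree's
strong-coupling phase predicate `StrongCouplingPhaseAt d N β` holds (unique limit, every free-boundary limit equal to it,
exponential decay of plaquette correlations). No new idea; no number beyond `1/(8d)`.
-/

noncomputable section

open Literature.MathematicalPhysics.QuantumLattice (fundamentalRep HasUniqueInfiniteVolumeLimit)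
open Literature.MathematicalPhysics.QuantumFieldTheory
open Summit.Ventures.YMGap.HessianSharp (sharpThresholdSU SharpUniqueness StrongCouplingPhaseAt
  hasUniqueInfiniteVolumeLimit_sharp_of_uniqueness strongCouplingPhase_sharp_of_uniqueness massGapAt_sharp_of_uniqueness)
open Summit.Ventures.YMGap.SharpClustering (shenZhuZhu_massGap_transfer_holds)

namespace Summit.Ventures.YMGap

namespace SharpUniquenessJoin

variable {d N : ℕ}

/-- ★ **Unique thermodynamic limit at the sharp window, hypothesis-free**: for `d ≥ 1`, `N ≥ 2` and every 't Hooft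
`|β| < 1/(8d)`, the periodic `SU(N)` Wilson states at tree coupling `N β` converge (full sequence) to one state, the only
subsequential limit point (`HasUniqueInfiniteVolumeLimit`). -/
theorem hasUniqueInfiniteVolumeLimit_sharp_free (hd : 1 ≤ d) (hN : 2 ≤ N) {β : ℝ} (hβ : |β| < sharpThresholdSU d) :
    HasUniqueInfiniteVolumeLimit (d := d) (fundamentalRep (Fin N)) ((N : ℝ) * β) :=
  hasUniqueInfiniteVolumeLimit_sharp_of_uniqueness (sharpUniqueness_free hd hN) hβ

/-- ★ **`MassGapAt` at one sharp coupling, hypothesis-free** (pointwise form of `massGapBelow_sharp_free`): `d, N ≥ 2`,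
`|β| < 1/(8d)` ⇒ `MassGapAt d N β`. -/
theorem massGapAt_sharp_free (hd : 2 ≤ d) (hN : 2 ≤ N) {β : ℝ} (hβ : |β| < sharpThresholdSU d) : MassGapAt d N β :=
  massGapAt_sharp_of_uniqueness (shenZhuZhu_massGap_transfer_holds d N) (sharpUniqueness_free (le_trans one_le_two hd) hN)
    hd hN hβ

/-- ★ **The strong-coupling PHASE statement on `|β_tree| < N/(8d)`, hypothesis-free**: for `d, N ≥ 2` and every TREE coupling
`|β| < N/(8d)` ('t Hooft `|β|/N < 1/(8d)`), `StrongCouplingPhaseAt d N β` — the periodic `SU(N)` Wilson states converge to a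
translation-invariant `μ`, every free-boundary limit equals `μ`, and plaquette correlations decay exponentially under `μ`. -/
theorem strongCouplingPhase_sharp_free (hd : 2 ≤ d) (hN : 2 ≤ N) {β : ℝ} (hβ : |β| < N / (8 * d)) :
    StrongCouplingPhaseAt d N β :=
  strongCouplingPhase_sharp_of_uniqueness (shenZhuZhu_massGap_transfer_holds d N)
    (sharpUniqueness_free (le_trans one_le_two hd) hN) hN hd hβ

end SharpUniquenessJoin

end Summit.Ventures.YMGap
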